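import Summits.QuantumFields.QCD.Theorems.SmallFieldUltracontractivity.Negative.Tightness
import Literature.MathematicalPhysics.QuantumLattice.LatticeToriProofs

/-!
# Caloric fixed point — part B: the product cutoff of scale `N`
(helpers of the line lead for `stub_caloricFixedPoint`, crux `SmallFieldUltracontractivity`,
item stmt-QuantumFields-8871, line `point-centred-axial-parabolic`)

The spatial cutoff of the cut-off Duhamel parametrix is the explicit product profile
`χ_{x,N}(z) = Π_ν f(c_ν(z)/N)`, `c_ν(z) = min ((z−x) ν).val (L − ((z−x) ν).val)` (cyclic distance of the
`ν`-th coordinate to the centre) with the `C¹` bump `f(u) = (max 0 (1 − (max 0 (u−1))²))²` (`= 1` for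
`u ≤ 1`, `= 0` for `u ≥ 2`).  Here: `0 ≤ f ≤ 1`, `f` is `4`-Lipschitz; `0 ≤ χ ≤ 1`, `χ(x) = 1`, `χ(z) = 0`
once `2N ≤ torusDist x z`, and `|χ(z) − χ(z')| ≤ 16/N` for `torusDist z z' ≤ 1` (no unwrapping of the
torus is needed: the cyclic distance is subadditive, `cyclicAbs_add_le`).  The same expression appears
verbatim in the registered stubs `stub_commutatorBound` / `stub_caloricFixedPoint`.  Pure bookkeeping.
-/

noncomputable section

namespace Summit.QuantumFields.QCD.Cruxes.SmallFieldUltracontractivity.PointCentredAxialParabolic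

open Literature.MathematicalPhysics.QuantumLattice Literature.MathematicalPhysics.QuantumFieldTheory
open Literature.Probability.LatticeModels (TorusSite)
open Finset

/-! ### The one-variable bump `f(u) = (max 0 (1 − (max 0 (u−1))²))²` -/

/-- `0 ≤ f`. -/
theorem bump_nonneg (u : ℝ) : 0 ≤ (max 0 (1 - (max 0 (u - 1)) ^ 2)) ^ 2 := sq_nonneg _

/-- `f ≤ 1`. -/
theorem bump_le_one (u : ℝ) : (max 0 (1 - (max 0 (u - 1)) ^ 2)) ^ 2 ≤ 1 := by
  have h0 : 0 ≤ max 0 (1 - (max 0 (u - 1)) ^ 2) := le_max_left _ _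
  have h1 : max 0 (1 - (max 0 (u - 1)) ^ 2) ≤ 1 :=
    max_le zero_le_one (by nlinarith [sq_nonneg (max 0 (u - 1))])
  nlinarith

/-- `f(u) = 1` for `u ≤ 1`. -/
theorem bump_eq_one {u : ℝ} (hu : u ≤ 1) : (max 0 (1 - (max 0 (u - 1)) ^ 2)) ^ 2 = 1 := by
  rw [max_eq_left (by linarith : u - 1 ≤ 0)]
  norm_num

/-- `f(u) = 0` for `2 ≤ u`. -/
theorem bump_eq_zero {u : ℝ} (hu : 2 ≤ u) : (max 0 (1 - (max 0 (u - 1)) ^ 2)) ^ 2 = 0 := by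
  rw [max_eq_right (by linarith : (0 : ℝ) ≤ u - 1)]
  have : 1 - (u - 1) ^ 2 ≤ 0 := by nlinarith
  rw [max_eq_left this]
  norm_num

/-- The inner clipped parabola `g(w) = max 0 (1 − w²)` is `2`-Lipschitz on `[0, ∞)`. -/
theorem abs_clip_sub_clip_le {w w' : ℝ} (hw : 0 ≤ w) (hw' : 0 ≤ w') :
    |max 0 (1 - w ^ 2) - max 0 (1 - w' ^ 2)| ≤ 2 * |w - w'| := by
  -- case analysis on `w ≤ 1`, `w' ≤ 1`
  rcases le_or_gt w 1 with h1 | h1 <;> rcases le_or_gt w' 1 with h2 | h2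
  · rw [max_eq_right (by nlinarith : (0:ℝ) ≤ 1 - w ^ 2), max_eq_right (by nlinarith : (0:ℝ) ≤ 1 - w' ^ 2)]
    have : (1 - w ^ 2) - (1 - w' ^ 2) = (w' - w) * (w' + w) := by ring
    rw [this, abs_mul, abs_sub_comm]
    have hs : |w' + w| ≤ 2 := by rw [abs_of_nonneg (by linarith)]; linarith
    calc |w - w'| * |w' + w| ≤ |w - w'| * 2 := mul_le_mul_of_nonneg_left hs (abs_nonneg _)
      _ = 2 * |w - w'| := by ring
  · rw [max_eq_right (by nlinarith : (0:ℝ) ≤ 1 - w ^ 2), max_eq_left (by nlinarith : 1 - w' ^ 2 ≤ 0),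
      sub_zero, abs_of_nonneg (by nlinarith : (0:ℝ) ≤ 1 - w ^ 2), abs_of_nonpos (by linarith : w - w' ≤ 0)]
    nlinarith
  · rw [max_eq_left (by nlinarith : 1 - w ^ 2 ≤ 0), max_eq_right (by nlinarith : (0:ℝ) ≤ 1 - w' ^ 2),
      zero_sub, abs_neg, abs_of_nonneg (by nlinarith : (0:ℝ) ≤ 1 - w' ^ 2),
      abs_of_nonneg (by linarith : 0 ≤ w - w')]
    nlinarith
  · rw [max_eq_left (by nlinarith : 1 - w ^ 2 ≤ 0), max_eq_left (by nlinarith : 1 - w' ^ 2 ≤ 0), sub_zero,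
      abs_zero]
    positivity

/-- **`f` is `4`-Lipschitz**: `|f(u) − f(v)| ≤ 4|u − v|`. -/
theorem abs_bump_sub_bump_le (u v : ℝ) :
    |(max 0 (1 - (max 0 (u - 1)) ^ 2)) ^ 2 - (max 0 (1 - (max 0 (v - 1)) ^ 2)) ^ 2| ≤ 4 * |u - v| := by
  set a := max 0 (1 - (max 0 (u - 1)) ^ 2) with ha
  set b := max 0 (1 - (max 0 (v - 1)) ^ 2) with hb
  have ha0 : 0 ≤ a := le_max_left _ _
  have hb0 : 0 ≤ b := le_max_left _ _
  have ha1 : a ≤ 1 := max_le zero_le_one (by nlinarith [sq_nonneg (max 0 (u - 1))])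
  have hb1 : b ≤ 1 := max_le zero_le_one (by nlinarith [sq_nonneg (max 0 (v - 1))])
  have hab : |a - b| ≤ 2 * |max 0 (u - 1) - max 0 (v - 1)| :=
    abs_clip_sub_clip_le (le_max_left _ _) (le_max_left _ _)
  have hmax : |max 0 (u - 1) - max 0 (v - 1)| ≤ |u - v| := by
    have h := abs_max_sub_max_le_abs (u - 1) (v - 1) (0 : ℝ)
    rw [max_comm (u - 1), max_comm (v - 1)] at h
    have : u - 1 - (v - 1) = u - v := by ring
    rwa [this] at h
  have hsq : a ^ 2 - b ^ 2 = (a - b) * (a + b) := by ring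
  rw [hsq, abs_mul]
  have hs : |a + b| ≤ 2 := by rw [abs_of_nonneg (by linarith)]; linarith
  calc |a - b| * |a + b| ≤ (2 * |u - v|) * 2 :=
        mul_le_mul (hab.trans (by linarith)) hs (abs_nonneg _) (by positivity)
    _ = 4 * |u - v| := by ring

/-! ### Products of `1`-bounded reals -/

/-- Telescoping: `|∏ aᵢ − ∏ bᵢ| ≤ ∑ |aᵢ − bᵢ|` when `|aᵢ|, |bᵢ| ≤ 1` (folklore; same proof as
`Literature.Barriers.Parity.SiegelZeroDichotomyChowlaModel.abs_prod_sub_prod_le`). -/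
theorem abs_prod_sub_prod_le_sum {κ : Type*} (s : Finset κ) {a b : κ → ℝ}
    (ha : ∀ i ∈ s, |a i| ≤ 1) (hb : ∀ i ∈ s, |b i| ≤ 1) :
    |∏ i ∈ s, a i - ∏ i ∈ s, b i| ≤ ∑ i ∈ s, |a i - b i| := by
  classical
  induction s using Finset.induction_on with
  | empty => simp
  | insert j s hj ih =>
    rw [Finset.prod_insert hj, Finset.prod_insert hj, Finset.sum_insert hj]
    have ha' : ∀ i ∈ s, |a i| ≤ 1 := fun i hi => ha i (Finset.mem_insert_of_mem hi)
    have hb' : ∀ i ∈ s, |b i| ≤ 1 := fun i hi => hb i (Finset.mem_insert_of_mem hi)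
    have hbj : |∏ i ∈ s, b i| ≤ 1 := by
      rw [Finset.abs_prod]
      exact Finset.prod_le_one (fun i _ => abs_nonneg _) hb'
    have h : a j * ∏ i ∈ s, a i - b j * ∏ i ∈ s, b i
        = a j * (∏ i ∈ s, a i - ∏ i ∈ s, b i) + (a j - b j) * ∏ i ∈ s, b i := by ring
    calc |a j * ∏ i ∈ s, a i - b j * ∏ i ∈ s, b i|
        = |a j * (∏ i ∈ s, a i - ∏ i ∈ s, b i) + (a j - b j) * ∏ i ∈ s, b i| := by rw [h]
      _ ≤ |a j * (∏ i ∈ s, a i - ∏ i ∈ s, b i)| + |(a j - b j) * ∏ i ∈ s, b i| := abs_add_le _ _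
      _ = |a j| * |∏ i ∈ s, a i - ∏ i ∈ s, b i| + |a j - b j| * |∏ i ∈ s, b i| := by
          rw [abs_mul, abs_mul]
      _ ≤ 1 * (∑ i ∈ s, |a i - b i|) + |a j - b j| * 1 := by
          gcongr
          · exact ha j (Finset.mem_insert_self j s)
          · exact ih ha' hb'
      _ = |a j - b j| + ∑ i ∈ s, |a i - b i| := by ring

/-! ### The product cutoff on the torus -/

section Torus

variable {L : ℕ}

/-- `0 ≤ χ`. -/
theorem cutoff_nonneg (x : TorusSite 4 L) (N : ℕ) (z : TorusSite 4 L) :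
    0 ≤ ∏ ν : Fin 4, (max 0 (1 - (max 0 ((min ((z - x) ν).val (L - ((z - x) ν).val) : ℝ) / (N : ℝ) - 1)) ^ 2)) ^ 2 :=
  Finset.prod_nonneg fun _ _ => bump_nonneg _

/-- `χ ≤ 1`. -/
theorem cutoff_le_one (x : TorusSite 4 L) (N : ℕ) (z : TorusSite 4 L) :
    ∏ ν : Fin 4, (max 0 (1 - (max 0 ((min ((z - x) ν).val (L - ((z - x) ν).val) : ℝ) / (N : ℝ) - 1)) ^ 2)) ^ 2 ≤ 1 :=
  Finset.prod_le_one (fun _ _ => bump_nonneg _) fun _ _ => bump_le_one _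

/-- `χ(x) = 1` (every cyclic coordinate distance vanishes at the centre). -/
theorem cutoff_self (x : TorusSite 4 L) (N : ℕ) :
    ∏ ν : Fin 4, (max 0 (1 - (max 0 ((min ((x - x) ν).val (L - ((x - x) ν).val) : ℝ) / (N : ℝ) - 1)) ^ 2)) ^ 2 = 1 := by
  refine Finset.prod_eq_one fun ν _ => bump_eq_one ?_
  simp only [sub_self, Pi.zero_apply, ZMod.val_zero, Nat.cast_zero, sub_zero]
  rw [min_eq_left (Nat.cast_nonneg L)]
  norm_num

/-- The torus distance to the centre is the maximum of the cyclic coordinate distances `c_ν(z)`. -/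
theorem torusDist_eq_sup_cyclic (x z : TorusSite 4 L) :
    torusDist x z = Finset.univ.sup fun ν : Fin 4 => min ((z - x) ν).val (L - ((z - x) ν).val) := by
  rw [torusDist_comm']
  rfl

variable [NeZero L]

/-- The real form of a cyclic coordinate distance (as the registered statements elaborate it) is the
cast of the natural-number one. -/
theorem real_cyclic_eq_cast (a : ZMod L) :
    min ((a.val : ℕ) : ℝ) ((L : ℝ) - ((a.val : ℕ) : ℝ)) = ((min a.val (L - a.val) : ℕ) : ℝ) := by
  rw [Nat.cast_min, Nat.cast_sub (ZMod.val_le a)]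

/-- `χ(z) = 0` as soon as `2N ≤ torusDist x z` (one coordinate has `c_ν ≥ 2N`, and `f = 0` on `[2,∞)`). -/
theorem cutoff_eq_zero_of_le_torusDist (x : TorusSite 4 L) {N : ℕ} (hN : 1 ≤ N) (z : TorusSite 4 L)
    (hz : 2 * N ≤ torusDist x z) :
    ∏ ν : Fin 4, (max 0 (1 - (max 0 ((min ((z - x) ν).val (L - ((z - x) ν).val) : ℝ) / (N : ℝ) - 1)) ^ 2)) ^ 2 = 0 := by
  rw [torusDist_eq_sup_cyclic] at hz
  obtain ⟨ν, -, hν⟩ := Finset.exists_mem_eq_sup (Finset.univ : Finset (Fin 4)) Finset.univ_nonempty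
    (fun ν : Fin 4 => min ((z - x) ν).val (L - ((z - x) ν).val))
  rw [hν] at hz
  refine Finset.prod_eq_zero (Finset.mem_univ ν) (bump_eq_zero ?_)
  have hNpos : (0 : ℝ) < N := by exact_mod_cast hN
  rw [le_div_iff₀ hNpos, real_cyclic_eq_cast]
  exact_mod_cast hz

/-- Cyclic coordinate distances to the centre change by at most the torus distance of a move:
`c_ν(z') ≤ c_ν(z) + torusDist z z'`. -/
theorem cyclic_coord_le_add_torusDist (x z z' : TorusSite 4 L) (ν : Fin 4) :
    min ((z' - x) ν).val (L - ((z' - x) ν).val) ≤ min ((z - x) ν).val (L - ((z - x) ν).val) + torusDist z z' := by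
  have hsplit : (z' - x) ν = (z - x) ν + (z' - z) ν := by
    simp only [Pi.sub_apply]
    ring
  rw [hsplit]
  have h1 := cyclicAbs_add_le L ((z - x) ν) ((z' - z) ν)
  have h2 : min ((z' - z) ν).val (L - ((z' - z) ν).val) ≤ torusDist z z' := by
    rw [torusDist_comm']
    unfold torusDist
    simp only [torusNorm]
    exact Finset.le_sup (f := fun i : Fin 4 => min ((z' - z) i).val (L - ((z' - z) i).val)) (Finset.mem_univ ν)
  omega

/-- **Lipschitz bound for the cutoff under unit moves**: `|χ(z) − χ(z')| ≤ 16/N` if `torusDist z z' ≤ 1`. -/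
theorem abs_cutoff_sub_cutoff_le (x : TorusSite 4 L) {N : ℕ} (hN : 1 ≤ N) {z z' : TorusSite 4 L}
    (hzz' : torusDist z z' ≤ 1) :
    |(∏ ν : Fin 4, (max 0 (1 - (max 0 ((min ((z - x) ν).val (L - ((z - x) ν).val) : ℝ) / (N : ℝ) - 1)) ^ 2)) ^ 2) -
      ∏ ν : Fin 4, (max 0 (1 - (max 0 ((min ((z' - x) ν).val (L - ((z' - x) ν).val) : ℝ) / (N : ℝ) - 1)) ^ 2)) ^ 2|
      ≤ 16 / (N : ℝ) := by
  have hNpos : (0 : ℝ) < N := by exact_mod_cast hN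
  refine (abs_prod_sub_prod_le_sum _ (fun ν _ => ?_) (fun ν _ => ?_)).trans ?_
  · rw [abs_of_nonneg (bump_nonneg _)]; exact bump_le_one _
  · rw [abs_of_nonneg (bump_nonneg _)]; exact bump_le_one _
  · have hterm : ∀ ν ∈ (Finset.univ : Finset (Fin 4)),
        |(max 0 (1 - (max 0 ((min ((z - x) ν).val (L - ((z - x) ν).val) : ℝ) / (N : ℝ) - 1)) ^ 2)) ^ 2 -
          (max 0 (1 - (max 0 ((min ((z' - x) ν).val (L - ((z' - x) ν).val) : ℝ) / (N : ℝ) - 1)) ^ 2)) ^ 2|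
          ≤ 4 / (N : ℝ) := by
      intro ν _
      refine (abs_bump_sub_bump_le _ _).trans ?_
      have h1 := cyclic_coord_le_add_torusDist x z z' ν
      have h2 := cyclic_coord_le_add_torusDist x z' z ν
      rw [torusDist_comm'] at h2
      have hdiff : |((min ((z - x) ν).val (L - ((z - x) ν).val) : ℕ) : ℝ) -
          ((min ((z' - x) ν).val (L - ((z' - x) ν).val) : ℕ) : ℝ)| ≤ 1 := by
        rw [abs_le]
        constructor
        · have : ((min ((z' - x) ν).val (L - ((z' - x) ν).val) : ℕ) : ℝ) ≤
              (min ((z - x) ν).val (L - ((z - x) ν).val) : ℕ) + 1 := by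
            exact_mod_cast h1.trans (by omega)
          linarith
        · have : ((min ((z - x) ν).val (L - ((z - x) ν).val) : ℕ) : ℝ) ≤
              (min ((z' - x) ν).val (L - ((z' - x) ν).val) : ℕ) + 1 := by
            exact_mod_cast h2.trans (by omega)
          linarith
      rw [real_cyclic_eq_cast, real_cyclic_eq_cast]
      have key : ∀ p q : ℝ, |p - q| ≤ 1 → 4 * |p / (N : ℝ) - q / (N : ℝ)| ≤ 4 / (N : ℝ) := by
        intro p q hpq
        rw [← sub_div, abs_div, abs_of_pos hNpos]
        calc 4 * (|p - q| / (N : ℝ)) ≤ 4 * (1 / (N : ℝ)) := by gcongr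
          _ = 4 / (N : ℝ) := by ring
      exact key _ _ hdiff
    calc _ ≤ ∑ ν : Fin 4, 4 / (N : ℝ) := Finset.sum_le_sum hterm
      _ = 16 / (N : ℝ) := by simp; ring

end Torus

/-- **Registered form (stub `stub_cutoffFacts` of the crux item)**: the four facts about the product
cutoff `χ_{x,N}` used by the caloric fixed point: `χ(x) = 1`, `0 ≤ χ ≤ 1`, `χ = 0` beyond torus
distance `2N`, and the `16/N`-Lipschitz bound under unit moves. -/
theorem stub_cutoffFacts :
    ∀ (L : ℕ) [NeZero L] (x : TorusSite 4 L) (N : ℕ), 1 ≤ N →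
      (∏ ν : Fin 4, (max 0 (1 - (max 0 ((min ((x - x) ν).val (L - ((x - x) ν).val) : ℝ) / (N : ℝ) - 1)) ^ 2)) ^ 2) = 1 ∧
      (∀ z : TorusSite 4 L, 0 ≤ (∏ ν : Fin 4, (max 0 (1 - (max 0 ((min ((z - x) ν).val (L - ((z - x) ν).val) : ℝ) / (N : ℝ) - 1)) ^ 2)) ^ 2) ∧ (∏ ν : Fin 4, (max 0 (1 - (max 0 ((min ((z - x) ν).val (L - ((z - x) ν).val) : ℝ) / (N : ℝ) - 1)) ^ 2)) ^ 2) ≤ 1) ∧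
      (∀ z : TorusSite 4 L, 2 * N ≤ torusDist x z → (∏ ν : Fin 4, (max 0 (1 - (max 0 ((min ((z - x) ν).val (L - ((z - x) ν).val) : ℝ) / (N : ℝ) - 1)) ^ 2)) ^ 2) = 0) ∧
      (∀ z z' : TorusSite 4 L, torusDist z z' ≤ 1 → |(∏ ν : Fin 4, (max 0 (1 - (max 0 ((min ((z - x) ν).val (L - ((z - x) ν).val) : ℝ) / (N : ℝ) - 1)) ^ 2)) ^ 2) - (∏ ν : Fin 4, (max 0 (1 - (max 0 ((min ((z' - x) ν).val (L - ((z' - x) ν).val) : ℝ) / (N : ℝ) - 1)) ^ 2)) ^ 2)| ≤ 16 / (N : ℝ)) :=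
  fun _ _ x _ hN =>
    ⟨cutoff_self x _, fun z => ⟨cutoff_nonneg x _ z, cutoff_le_one x _ z⟩,
      fun z hz => cutoff_eq_zero_of_le_torusDist x hN z hz,
      fun _ _ hzz' => abs_cutoff_sub_cutoff_le x hN hzz'⟩

end Summit.QuantumFields.QCD.Cruxes.SmallFieldUltracontractivity.PointCentredAxialParabolic

end
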